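import Summits.BirchSwinnertonDyer.BirchSwinnertonDyer.Theses.GoldfeldAllTwistsTwoConverse
import Summits.BirchSwinnertonDyer.BirchSwinnertonDyer.Theorems.GoldfeldGoodTwistsAllTwistsCells
import Summits.BirchSwinnertonDyer.Rank1Residual.X12.CMTwoTorsion
import Literature.NumberTheory.EllipticCurves.BurungaleCastellaSkinnerTian2022.CMPConverseAtTwo
import Literature.NumberTheory.EllipticCurves.BSDSelmerCMPConverseMaximalOrderProofs
import HarnessLib

set_option linter.dupNamespace false -- namespace `…BirchSwinnertonDyer.BirchSwinnertonDyer…` is the cell's (D-0017 nested layout)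
set_option autoImplicit false

/-!
# Route `GoldfeldAllTwistsTwoConverse`, crux K12₂′ `RankOneTwoConverseCMSevenAtAnyTwo` (item 19349):
# the registered print stub `stub_twoConverse_good` is EXACTLY the `p = 2` slice of BCST Thm. A,
# and the crux is EXACTLY the conjunction of its two remaining registered stubs (print-free)

Leafhand `leafhand-bsd-goldfeldalltwistst-1` g0 (2026-08-30), `--supports stmt-BirchSwinnertonDyer-19349`. Def-free helper;
no `sorry`, no new named fact. HONEST FRAMING: nothing here proves K12₂′, K12₂″, Theorem A or BSD for any curve.

The registered birth skeleton of K12₂′ (`Cruxes/RankOneTwoConverseCMSevenAtAnyTwo/Lines/birth.lean`, sha16 9e7b3962da790c1f)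
has three stubs: M `stub_modelReduction` (closed BY NAME, p793883), L `stub_twoConverse_good` — the GOOD cell

  `GoodCellAtTwo := ∀ W [IsElliptic] [IsGloballyMinimal], j(W) = −3375 → good at 2 → corank_{ℤ₂} Sel_{2^∞}(W/ℚ) = 1 → r_an = 1`

— and XL `stub_twoConverse_additive` (VERBATIM the child crux K12₂″ = `RankOneTwoConverseCMSevenAdditiveTwo`, item 20044).
The landed glue (`…AtTwoGlue`, ty g12) proves `K12₂′ ↔ K12₂″ ∧ ThmA_at_two` through the Literature constant
`BurungaleCastellaSkinnerTian2022.ThmA_at_two` (Burungale–Castella–Skinner–Tian 2022 Thm. A at `p = 2`: every CM `E/ℚ` with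
`𝔡_K ∥ 𝔣_λ` and good ORDINARY reduction at `2`, `corank 1 ⟹ r_an = 1`) and the implication `ThmA_at_two → GoodCellAtTwo`
(`rankOneTwoConverse_goodCell_of_thmA_at_two`). This file adds the two missing arrows, both UNCONDITIONAL:

* §1 `thmA_at_two_of_goodCellAtTwo : GoodCellAtTwo → ThmA_at_two` — the good cell on the single `j`-class `−3375` already
  gives the whole `p = 2` slice: good ordinary at `2` forces `d_K = −7` (tree `X12.cmFieldDiscrOfJ_eq_neg_seven_of_goodOrd_two`,
  Deuring-free), i.e. `j ∈ {−3375, 16581375}` (`X12.j_eq_of_cmFieldDiscrOfJ_eq_neg_seven`); a curve with `j = 16581375` is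
  `ℚ`-isogenous to a globally minimal one with `j = −3375` (`exists_isGloballyMinimal_isIsogenous_j_eq_neg3375`, file 13), and
  good reduction at `2` (Silverman *AEC* Cor. VII.7.2, tree `IsIsogenous.hasGoodReductionAtPrime_iff`), the `2^∞`-Selmer corank
  (Greenberg, `IsIsogenous.selmerCorank_eq`) and the analytic rank (Faltings, `analyticRank_eq_of_isIsogenous'`) are isogeny
  invariants. Hence §2 `goodCellAtTwo_iff_thmA_at_two` — **the registered stub L is print-EXACT** (neither weaker nor stronger
  than the refereed statement it stands for; it closes exactly when `ThmA_at_two_holds` lands).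
* §3 `rankOneTwoConverseCMSevenAtAnyTwo_iff_additiveCell_and_goodCell : K12₂′ ↔ K12₂″ ∧ GoodCellAtTwo` — PRINT-FREE exactness of
  the registered partition: with M closed, the crux (route decl, by name) is literally the conjunction of its two open stubs
  (forward: both are specialisations; backward: stub M `modelReduction_rankOneTwoConverse` + the dichotomy at `2`).

References: [BurungaleCastellaSkinnerTian2022] Thm. A (p. 326), Rem. D (p. 327); [SilvermanAEC2009] Cor. VII.7.2, VIII.8 Cor. 8.3;
[Greenberg1999LNM] §1 pp. 54–57; [Faltings1983Endlichkeit] §5 Kor. 2; [Lang1987] Ch. 13 §4 Thm. 12 (Deuring).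
-/

noncomputable section

open scoped Classical

open WeierstrassCurve Literature.NumberTheory.EllipticCurves
  Literature.NumberTheory.EllipticCurves.Rank1Residual
  Literature.NumberTheory.EllipticCurves.BurungaleCastellaSkinnerTian2022

namespace Summit.BirchSwinnertonDyer.BirchSwinnertonDyer.Theorems.GoldfeldGoodTwists

open Summit.BirchSwinnertonDyer.Rank1Residual

/-! ## §1 The `p = 2` slice of Theorem A from the good cell on the `j = −3375` class -/

/-- **`GoodCellAtTwo → ThmA_at_two` (unconditional).** If the rank-one `2`-converse holds for every globally minimal `W/ℚ` with
`j(W) = −3375` and good reduction at `2` (the registered stub `stub_twoConverse_good` of crux K12₂′), then it holds for every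
CM `E/ℚ` with good ordinary reduction at `2` (Burungale–Castella–Skinner–Tian 2022 Thm. A at `p = 2`, the Literature `Prop`
`ThmA_at_two`; its conductor hypothesis is not even used): good ordinary at `2` forces `K = ℚ(√−7)`, i.e.
`j(E) ∈ {−3375, 16581375}`, and `E` is `ℚ`-isogenous to a globally minimal curve with `j = −3375`, good reduction at `2`,
the `2^∞`-Selmer corank and the analytic rank being isogeny invariants.
[cite: BurungaleCastellaSkinnerTian2022, Thm. A (p. 326) and Rem. D (p. 327)] [cite: SilvermanAEC2009, Cor. VII.7.2]
[cite: Greenberg1999LNM, §1 pp. 54–57] -/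
theorem thmA_at_two_of_goodCellAtTwo
    (hG : ∀ (W : WeierstrassCurve ℚ) [W.IsElliptic] [W.IsGloballyMinimal],
      W.j = -3375 → W.HasGoodReductionAtPrime 2 → W.selmerCorank 2 = 1 → W.analyticRank = 1) :
    ThmA_at_two := by
  intro W _ _ hCM _ _ hgood hord hsel
  have hK : cmFieldDiscrOfJ W.j = -7 := X12.cmFieldDiscrOfJ_eq_neg_seven_of_goodOrd_two W hCM hgood hord
  have hj : W.j = -3375 ∨ W.j = 16581375 := X12.j_eq_of_cmFieldDiscrOfJ_eq_neg_seven hK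
  obtain ⟨W', hE', hmin', hiso, hj'⟩ := exists_isGloballyMinimal_isIsogenous_j_eq_neg3375 W hj
  have hgood' : W'.HasGoodReductionAtPrime 2 := (hiso.hasGoodReductionAtPrime_iff 2).mp hgood
  have hsel' : W'.selmerCorank 2 = 1 := by rw [← hiso.selmerCorank_eq 2]; exact hsel
  rw [analyticRank_eq_of_isIsogenous' hiso]
  exact hG W' hj' hgood' hsel'

/-! ## §2 The registered print stub is EXACTLY the `p = 2` slice of Theorem A -/

/-- **`GoodCellAtTwo ↔ ThmA_at_two` (unconditional, binder-free).** The registered stub `stub_twoConverse_good` of crux K12₂′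
(the good cell on the `j = −3375` class) is EQUIVALENT to Burungale–Castella–Skinner–Tian 2022 Thm. A at `p = 2`
(`ThmA_at_two`): §1 and, conversely, Deuring at `2` for `d_K = −7` (good ⟹ ordinary, tree
`X12.goodOrd_two_of_cmFieldDiscrOfJ_eq_neg_seven`) with the automatic conductor hypothesis
(`X12.differentExactlyDividesHeckeConductor_of_cmFieldDiscrOfJ_eq_neg_seven`). So the stub closes by name exactly when the
print is formalised (`ThmA_at_two_holds`), and asks for nothing more.
[cite: BurungaleCastellaSkinnerTian2022, Thm. A (p. 326) and Rem. D (p. 327)] [cite: Lang1987, Ch. 13 §4 Thm. 12] -/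
theorem goodCellAtTwo_iff_thmA_at_two :
    (∀ (W : WeierstrassCurve ℚ) [W.IsElliptic] [W.IsGloballyMinimal],
      W.j = -3375 → W.HasGoodReductionAtPrime 2 → W.selmerCorank 2 = 1 → W.analyticRank = 1) ↔ ThmA_at_two := by
  refine ⟨thmA_at_two_of_goodCellAtTwo, fun hA2 W _ _ hj hgood hsel => ?_⟩
  have hK : cmFieldDiscrOfJ W.j = -7 := cmFieldDiscrOfJ_eq_neg_seven_of_j_eq W (Or.inl hj)
  have hGO : GoodOrd W 2 := X12.goodOrd_two_of_cmFieldDiscrOfJ_eq_neg_seven W hgood hK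
  have hCM : W.HasCM := hasCM_of_j_eq_neg3375 W hj
  exact hA2 W hCM (X12.differentExactlyDividesHeckeConductor_of_cmFieldDiscrOfJ_eq_neg_seven W hCM hK) hgood hGO.2 hsel

/-! ## §3 The crux is EXACTLY the conjunction of its two open registered stubs (print-free) -/

/-- **K12₂′ ↔ K12₂″ ∧ GoodCellAtTwo (unconditional, print-free).** The crux `RankOneTwoConverseCMSevenAtAnyTwo` (item 19349,
route decl by name) is EQUIVALENT to the conjunction of its additive cell `RankOneTwoConverseCMSevenAdditiveTwo` (item 20044 =
registered stub `stub_twoConverse_additive` verbatim) and its good cell (= registered stub `stub_twoConverse_good` verbatim):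
forward, both cells are specialisations of the model-free crux; backward, reduce to a globally minimal isogenous model with
`j = −3375` (stub M, `modelReduction_rankOneTwoConverse`) and split on good / not good at `2`. With stub M closed (p793883)
the registered partition of line `birth` is therefore exact: nothing in it is wider than the crux.
[cite: BurungaleCastellaSkinnerTian2022, Rem. D (p. 327)] [cite: Greenberg1999LNM, §1 pp. 54–57] -/
theorem rankOneTwoConverseCMSevenAtAnyTwo_iff_additiveCell_and_goodCell :
    Summit.BirchSwinnertonDyer.BirchSwinnertonDyer.Theses.GoldfeldAllTwistsTwoConverse.RankOneTwoConverseCMSevenAtAnyTwo ↔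
      Summit.BirchSwinnertonDyer.BirchSwinnertonDyer.Theses.GoldfeldAllTwistsTwoConverse.RankOneTwoConverseCMSevenAdditiveTwo ∧
        (∀ (W : WeierstrassCurve ℚ) [W.IsElliptic] [W.IsGloballyMinimal],
          W.j = -3375 → W.HasGoodReductionAtPrime 2 → W.selmerCorank 2 = 1 → W.analyticRank = 1) := by
  refine ⟨fun h => ⟨fun W _ _ hj _ hsel => h W (Or.inl hj) hsel, fun W _ _ hj _ hsel => h W (Or.inl hj) hsel⟩,
    fun h W _ hj hsel => ?_⟩
  obtain ⟨W', hE', hmin', hj', hsel', har⟩ := modelReduction_rankOneTwoConverse W hj hsel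
  rw [← har]
  by_cases hg : W'.HasGoodReductionAtPrime 2
  · exact h.2 W' hj' hg hsel'
  · exact h.1 W' hj' hg hsel'

end Summit.BirchSwinnertonDyer.BirchSwinnertonDyer.Theorems.GoldfeldGoodTwists

end
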